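import Mathlib
import HarnessLib

/-!
# ValiantsHypothesis / LacunarySymmetroid — crux `MatrixDescartes` (stmt-ValiantsHypothesis-18050, V1),
# LINE (A) «product_plus_one» (`Cruxes/MatrixDescartes/Lines/product_plus_one.lean` @a0cf3f5276f3):
# ROW CALIBRATION — the `x ↦ −x` transfer and the ROLLE FLOOR `m(K−1)` of the class rows `PPOLawAt`

The line's rows `PPOLawAt m K B` count ALL distinct real zeros of the members
`C c * X ^ (m * d l₀) + ∏ j, fewnomial d (a j)`; the kernel rungs (`…ProductPlusOnePosCoeff`, `…ProductPlusOneEulerRolle`)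
count POSITIVE zeros.  This file supplies the two bookkeeping facts every row needs:

* `card_roots_le_pos_add_reflect_add_one` — `Z(h) ≤ Z₊(h) + Z₊(h(−X)) + 1` for every real polynomial;
  `class_comp_neg_X` — the class is CLOSED under `x ↦ −x` (`a_{jl} ↦ (−1)^{d_l} a_{jl}`, `c ↦ (−1)^N c`), hence
  `card_roots_class_le_of_pos` — a positive-zero bound `P` valid for all coefficients gives the row bound `2P + 1`
  (line shape unfolded verbatim), and `ppoLawAt_of_pos_count` — the same as the line's row `PPOLawAt m K (2B+1)` verbatim;
* `le_of_ppoLawAt` — the ROLLE FLOOR of the card (§Why it bites (iii), «members reach `m(K−1)`»): every row satisfies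
  `PPOLawAt m K B → m·(K−1) ≤ B` (`K ≥ 1`), witnessed by the `c = 0` member whose factors are
  `∏_{i<K−1} (X − r_{ji})` on the support `{0, 1, …, K−1}` with `m(K−1)` distinct roots (`floor_witness`).
  So no class law is better than LINEAR in `m·K`; `PPOLinearLaw` (`2mK+3`) is tight up to the constant.

HONEST FRAMING: calibration of the line's rows; NOT `stub_classRowK3`, not `stub_polyLaw` / `PPOPolyLaw`, not
`ProductPlusOneMDR`, not `MatrixDescartes`, not Conjecture B; `VP ≠ VNP` is NOT proved.  No definitions, no named facts;
Mathlib only.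
-/

-- `Summit.ValiantsHypothesis.ValiantsHypothesis.…` is the tree's mandated single-conjunct layout (Sub = Summit).
set_option linter.dupNamespace false

namespace Summit.ValiantsHypothesis.ValiantsHypothesis.Theorems.LacunarySymmetroidMatrixDescartes

namespace ProductPlusOne

open Polynomial Finset
open scoped BigOperators

/-! ### From positive zeros to all real zeros -/

/-- `Z(h) ≤ Z₊(h) + Z₊(h(−X)) + 1` (negative zeros of `h` are positive zeros of `h(−X)`; and possibly `0`). [folklore] -/
theorem card_roots_le_pos_add_reflect_add_one (h : ℝ[X]) :
    h.roots.toFinset.card ≤ (h.roots.toFinset.filter (fun t => 0 < t)).card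
      + ((h.comp (-X)).roots.toFinset.filter (fun t => 0 < t)).card + 1 := by
  classical
  have hsub : h.roots.toFinset ⊆ h.roots.toFinset.filter (fun t => 0 < t)
      ∪ h.roots.toFinset.filter (fun t => t < 0) ∪ {0} := by
    intro x hx
    rcases lt_trichotomy x 0 with hlt | heq | hgt
    · exact mem_union_left _ (mem_union_right _ (mem_filter.mpr ⟨hx, hlt⟩))
    · rw [heq]
      exact mem_union_right _ (mem_singleton_self 0)
    · exact mem_union_left _ (mem_union_left _ (mem_filter.mpr ⟨hx, hgt⟩))
  have hN : (h.roots.toFinset.filter (fun t => t < 0)).card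
      ≤ ((h.comp (-X)).roots.toFinset.filter (fun t => 0 < t)).card := by
    refine Finset.card_le_card_of_injOn (fun x => -x) (fun x hx => ?_) (fun x _ y _ hxy => neg_injective hxy)
    rw [mem_coe, mem_filter, Multiset.mem_toFinset] at hx
    rw [mem_coe, mem_filter, Multiset.mem_toFinset, roots_comp_neg_X, Multiset.mem_map]
    exact ⟨⟨x, hx.1, rfl⟩, neg_pos.mpr hx.2⟩
  calc h.roots.toFinset.card
      ≤ (h.roots.toFinset.filter (fun t => 0 < t) ∪ h.roots.toFinset.filter (fun t => t < 0) ∪ {0}).card :=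
        card_le_card hsub
    _ ≤ (h.roots.toFinset.filter (fun t => 0 < t) ∪ h.roots.toFinset.filter (fun t => t < 0)).card
          + ({0} : Finset ℝ).card := card_union_le _ _
    _ ≤ (h.roots.toFinset.filter (fun t => 0 < t)).card + (h.roots.toFinset.filter (fun t => t < 0)).card + 1 := by
        rw [card_singleton]
        exact Nat.add_le_add_right (card_union_le _ _) 1
    _ ≤ _ := by omega

/-- A fewnomial reflected: `(Σ_l a_l X^(d l))(−X) = Σ_l (−1)^(d l) a_l X^(d l)`. [folklore] -/
theorem fewnomial_comp_neg_X {K : ℕ} (d : Fin K → ℕ) (b : Fin K → ℝ) :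
    (∑ l, C (b l) * X ^ (d l) : ℝ[X]).comp (-X) = ∑ l, C ((-1) ^ (d l) * b l) * X ^ (d l) := by
  rw [← coe_compRingHom_apply, map_sum]
  refine Finset.sum_congr rfl (fun l _ => ?_)
  rw [coe_compRingHom_apply, mul_comp, C_comp, X_pow_comp, neg_pow, map_mul, map_pow, map_neg, map_one]
  ring

/-- **The class is closed under `x ↦ −x`:** `(c X^N + ∏_j f_j)(−X) = (−1)^N c X^N + ∏_j f_j^−` with
`f_j^− = Σ_l (−1)^(d l) a_{jl} X^(d l)` on the SAME support. [folklore] -/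
theorem class_comp_neg_X {m K : ℕ} (d : Fin K → ℕ) (a : Fin m → Fin K → ℝ) (N : ℕ) (c : ℝ) :
    (C c * X ^ N + ∏ j, ∑ l, C (a j l) * X ^ (d l) : ℝ[X]).comp (-X)
      = C ((-1) ^ N * c) * X ^ N + ∏ j, ∑ l, C ((-1) ^ (d l) * a j l) * X ^ (d l) := by
  rw [add_comp, mul_comp, C_comp, X_pow_comp, Polynomial.prod_comp]
  congr 1
  · rw [neg_pow, map_mul, map_pow, map_neg, map_one]
    ring
  · exact Finset.prod_congr rfl (fun j _ => fewnomial_comp_neg_X d (a j))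

/-- **Row bound from a positive-zero bound** (line shape `C c * X ^ (m * d l₀) + ∏ j, fewnomial d (a j)` unfolded):
if every member on the support `d` with coupled letter `l₀` has at most `P` positive zeros, then every member has at most
`2P + 1` real zeros. [this file's theorem] -/
theorem card_roots_class_le_of_pos {m K : ℕ} (d : Fin K → ℕ) (l₀ : Fin K) (P : ℕ)
    (hpos : ∀ (a : Fin m → Fin K → ℝ) (c : ℝ),
      ((C c * X ^ (m * d l₀) + ∏ j, ∑ l, C (a j l) * X ^ (d l) : ℝ[X]).roots.toFinset.filter
        (fun t => 0 < t)).card ≤ P)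
    (a : Fin m → Fin K → ℝ) (c : ℝ) :
    (C c * X ^ (m * d l₀) + ∏ j, ∑ l, C (a j l) * X ^ (d l) : ℝ[X]).roots.toFinset.card ≤ 2 * P + 1 := by
  have h1 := card_roots_le_pos_add_reflect_add_one
    (C c * X ^ (m * d l₀) + ∏ j, ∑ l, C (a j l) * X ^ (d l) : ℝ[X])
  rw [class_comp_neg_X] at h1
  have h2 := hpos a c
  have h3 := hpos (fun j l => (-1) ^ (d l) * a j l) ((-1) ^ (m * d l₀) * c)
  beta_reduce at h3
  omega


/-- **Row from a positive-zero count** (desk RULING #298 (1); the line's `PPOLawAt m K (2*B+1)` UNFOLDED verbatim):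
a bound `B` on the positive zeros of EVERY member of format `(m, K)` gives the row `PPOLawAt m K (2B+1)`. [this file's theorem] -/
theorem ppoLawAt_of_pos_count (m K B : ℕ)
    (h : ∀ (d : Fin K → ℕ) (a : Fin m → Fin K → ℝ) (l₀ : Fin K) (c : ℝ),
      ((C c * X ^ (m * d l₀) + ∏ j, ∑ l, C (a j l) * X ^ (d l) : ℝ[X]).roots.toFinset.filter
        (fun t => 0 < t)).card ≤ B) :
    ∀ (d : Fin K → ℕ) (a : Fin m → Fin K → ℝ) (l₀ : Fin K) (c : ℝ),
      (C c * X ^ (m * d l₀) + ∏ j, ∑ l, C (a j l) * X ^ (d l) : ℝ[X]).roots.toFinset.card ≤ 2 * B + 1 :=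
  fun d a l₀ c => card_roots_class_le_of_pos d l₀ B (fun a' c' => h d a' l₀ c') a c

/-! ### The Rolle floor `m(K−1)` -/

/-- A product of linear factors is a fewnomial on the support `{0, …, n}` with its own coefficients. [folklore] -/
theorem prod_X_sub_C_eq_sum (n : ℕ) (r : Fin n → ℝ) :
    (∑ l : Fin (n + 1), C ((∏ i, (X - C (r i))).coeff (l : ℕ)) * X ^ (l : ℕ)) = ∏ i, (X - C (r i)) := by
  have hlt : (∏ i, (X - C (r i)) : ℝ[X]).natDegree < n + 1 := by
    rw [natDegree_finsetProd_X_sub_C_eq_card, card_univ, Fintype.card_fin]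
    exact Nat.lt_succ_self n
  have h := as_sum_range_C_mul_X_pow' _ hlt
  rw [Finset.sum_range] at h
  exact h.symm

/-- **Floor witness:** the `c = 0` member with factors `∏_{i<n} (X − r_{ji})`, `r_{ji} = finProdFinEquiv (j,i) + 1` pairwise
distinct, has at least `m·n` distinct real zeros. [folklore] -/
theorem floor_witness (m n : ℕ) :
    m * n ≤ (∏ j : Fin m, ∏ i : Fin n,
      (X - C (((finProdFinEquiv (j, i) : ℕ) : ℝ) + 1)) : ℝ[X]).roots.toFinset.card := by
  classical
  have hne : (∏ j : Fin m, ∏ i : Fin n, (X - C (((finProdFinEquiv (j, i) : ℕ) : ℝ) + 1)) : ℝ[X]) ≠ 0 :=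
    (monic_prod_of_monic _ _ (fun j _ => monic_prod_of_monic _ _ (fun i _ => monic_X_sub_C _))).ne_zero
  have hroot : ∀ p : Fin m × Fin n, (((finProdFinEquiv p : ℕ) : ℝ) + 1) ∈
      (∏ j : Fin m, ∏ i : Fin n, (X - C (((finProdFinEquiv (j, i) : ℕ) : ℝ) + 1)) : ℝ[X]).roots.toFinset := by
    rintro ⟨j, i⟩
    rw [Multiset.mem_toFinset, mem_roots hne, IsRoot.def, eval_prod, Finset.prod_eq_zero_iff]
    refine ⟨j, mem_univ _, ?_⟩
    rw [eval_prod, Finset.prod_eq_zero_iff]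
    exact ⟨i, mem_univ _, by rw [eval_sub, eval_X, eval_C, sub_self]⟩
  have hinj : Function.Injective (fun p : Fin m × Fin n => ((finProdFinEquiv p : ℕ) : ℝ) + 1) := by
    intro p q hpq
    have h1 : ((finProdFinEquiv p : ℕ) : ℝ) = ((finProdFinEquiv q : ℕ) : ℝ) := add_right_cancel hpq
    exact finProdFinEquiv.injective (Fin.ext (Nat.cast_injective h1))
  calc m * n = (Finset.univ : Finset (Fin m × Fin n)).card := by
        rw [card_univ, Fintype.card_prod, Fintype.card_fin, Fintype.card_fin]
    _ = ((Finset.univ : Finset (Fin m × Fin n)).image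
          (fun p : Fin m × Fin n => ((finProdFinEquiv p : ℕ) : ℝ) + 1)).card :=
        (card_image_of_injective _ hinj).symm
    _ ≤ _ := card_le_card (fun x hx => by
        obtain ⟨p, _, rfl⟩ := mem_image.mp hx
        exact hroot p)

/-- **THE ROLLE FLOOR of the class rows** (`PPOLawAt m K B` unfolded verbatim ⇒ `m (K−1) ≤ B`, for `K ≥ 1`):
no law for the product-plus-one class is better than linear in `m·K`. [this file's theorem] -/
theorem le_of_ppoLawAt (m K B : ℕ) (hK : 1 ≤ K)
    (h : ∀ (d : Fin K → ℕ) (a : Fin m → Fin K → ℝ) (l₀ : Fin K) (c : ℝ),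
      (C c * X ^ (m * d l₀) + ∏ j, ∑ l, C (a j l) * X ^ (d l) : ℝ[X]).roots.toFinset.card ≤ B) :
    m * (K - 1) ≤ B := by
  obtain ⟨n, rfl⟩ : ∃ n, K = n + 1 := ⟨K - 1, by omega⟩
  rw [Nat.add_sub_cancel]
  have hmem := h (fun l => (l : ℕ))
    (fun j l => (∏ i : Fin n, (X - C (((finProdFinEquiv (j, i) : ℕ) : ℝ) + 1))).coeff (l : ℕ)) 0 0
  beta_reduce at hmem
  rw [map_zero, zero_mul, zero_add] at hmem
  have hprod : (∏ j : Fin m, ∑ l : Fin (n + 1),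
        C ((∏ i : Fin n, (X - C (((finProdFinEquiv (j, i) : ℕ) : ℝ) + 1))).coeff (l : ℕ)) * X ^ (l : ℕ) : ℝ[X])
      = ∏ j : Fin m, ∏ i : Fin n, (X - C (((finProdFinEquiv (j, i) : ℕ) : ℝ) + 1)) :=
    Finset.prod_congr rfl (fun j _ => prod_X_sub_C_eq_sum n _)
  rw [hprod] at hmem
  exact (floor_witness m n).trans hmem

end ProductPlusOne

end Summit.ValiantsHypothesis.ValiantsHypothesis.Theorems.LacunarySymmetroidMatrixDescartes
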